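import Literature.AlgebraicGeometry.Resolution.ResolutionLocalization

/-!
# Generic point of the fibre of `𝔸ˢ_Y → Y` through a point

Crux `ProductDescent` (stmt-ResolutionOfSingularities-15231), line `birth`, stub
`stub_fibreGenericPoint`.

For `Y` an integral scheme over the prime field `𝔽_p = ZMod p` and a point `x` of the affine
space `𝔸ˢ_Y` lying over `y ∈ Y`, the generic point `ξ` of the fibre `𝔸ˢ_{κ(y)}` through `x` is a
point of `𝔸ˢ_Y` which specialises to `x`, lies over the same point `y`, and has the same image in
`𝔸ˢ_{𝔽_p}` as the generic point of `𝔸ˢ_Y` — namely the generic point of `𝔸ˢ_{𝔽_p}`: the fibre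
maps to `𝔸ˢ_{𝔽_p}` through `𝔸ˢ(Spec κ(y) → Spec 𝔽_p)`, which is `Spec` of the injective map
`𝔽_p[t] → κ(y)[t]`, while `𝔸ˢ_Y → 𝔸ˢ_{𝔽_p}` is surjective (a base change of `Y → Spec 𝔽_p`).

All statements are folklore; no named fact is introduced.
-/

noncomputable section

set_option linter.dupNamespace false

open CategoryTheory CategoryTheory.Limits AlgebraicGeometry Literature.AlgebraicGeometry.Resolution

namespace Summit.ResolutionOfSingularities.ResolutionOfSingularities.Theorems.ProductDescent.Birth

universe u

/-- A continuous map with dense range between irreducible quasi-sober spaces, the target being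
`T₀`, sends the generic point to the generic point. [folklore] -/
theorem apply_genericPoint_of_denseRange {α β : Type*} [TopologicalSpace α]
    [TopologicalSpace β] [QuasiSober α] [IrreducibleSpace α] [QuasiSober β] [IrreducibleSpace β]
    [T0Space β] {e : α → β} (he : Continuous e) (hd : DenseRange e) :
    e (genericPoint α) = genericPoint β := by
  have h := (genericPoint_spec α).image he
  rw [Set.image_univ, hd.closure_range] at h
  exact h.eq (genericPoint_spec β)

/-- A surjective morphism of irreducible schemes maps the generic point to the generic point.
[folklore] -/
theorem apply_genericPoint_of_surjective {X Z : Scheme.{u}} [IrreducibleSpace X]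
    [IrreducibleSpace Z] (g : X ⟶ Z) [Surjective g] :
    g.base (genericPoint X) = genericPoint Z :=
  apply_genericPoint_of_denseRange g.continuous g.surjective.denseRange

/-- For an injective ring map `φ : R → S` of domains, the morphism `𝔸ⁿ(Spec φ) : 𝔸ⁿ_S → 𝔸ⁿ_R`
maps the generic point to the generic point: up to the isomorphisms `𝔸ⁿ_{Spec A} ≅ Spec A[n]` it
is `Spec` of the injective map `R[n] → S[n]`. [folklore] -/
theorem affineSpace_map_SpecMap_genericPoint (n : Type u) {R S : CommRingCat.{u}} [IsDomain R]
    [IsDomain S] (φ : R ⟶ S) (hφ : Function.Injective φ.hom) :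
    (AffineSpace.map n (Spec.map φ)).base (genericPoint 𝔸(n; Spec S)) =
      genericPoint 𝔸(n; Spec R) := by
  haveI : IrreducibleSpace (Spec (.of (MvPolynomial n R)) : Scheme.{u}) :=
    inferInstanceAs (IrreducibleSpace (PrimeSpectrum (MvPolynomial n R)))
  haveI : IrreducibleSpace (Spec (.of (MvPolynomial n S)) : Scheme.{u}) :=
    inferInstanceAs (IrreducibleSpace (PrimeSpectrum (MvPolynomial n S)))
  rw [AffineSpace.map_SpecMap, Scheme.Hom.comp_apply, Scheme.Hom.comp_apply,
    apply_genericPoint_of_surjective (AffineSpace.SpecIso n S).hom]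
  letI : Algebra (MvPolynomial n R) (MvPolynomial n S) := (MvPolynomial.map φ.hom).toAlgebra
  have hgen : (Spec.map (CommRingCat.ofHom (MvPolynomial.map φ.hom)))
      (genericPoint (Spec (.of (MvPolynomial n S)))) =
        genericPoint (Spec (.of (MvPolynomial n R))) :=
    specMap_genericPoint_of_injective (B := MvPolynomial n R) (S := MvPolynomial n S)
      (MvPolynomial.map_injective φ.hom hφ)
  rw [hgen]
  exact apply_genericPoint_of_surjective (AffineSpace.SpecIso n R).inv

/-- **Generic point of the fibre.** Every point `x` of `𝔸ˢ_Y` (`Y` integral over `𝔽_p`) is a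
specialisation of a point `ξ` over the same point of `Y` having the same image in `𝔸ˢ_{𝔽_p}` as
the generic point of `𝔸ˢ_Y`, namely the generic point of the fibre `𝔸ˢ_{κ(y)}` through `x`.
[folklore] -/
theorem stub_fibreGenericPoint :
    ∀ p : ℕ, p.Prime → ∀ (Y : Scheme.{0}) (f : Y ⟶ Spec (.of (ZMod p))) [IsIntegral Y] (s : ℕ)
      (x : ↥(AffineSpace (Fin s) Y)),
      ∃ ξ : ↥(AffineSpace (Fin s) Y), ξ ⤳ x ∧
        (CategoryTheory.over (AffineSpace (Fin s) Y) Y).base ξ =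
          (CategoryTheory.over (AffineSpace (Fin s) Y) Y).base x ∧
        (AffineSpace.map (Fin s) f).base ξ =
          (AffineSpace.map (Fin s) f).base (genericPoint (AffineSpace (Fin s) Y)) := by
  intro p hp Y f _ s x
  haveI : Fact p.Prime := ⟨hp⟩
  -- the point `y` of `Y` under `x` and the fibre `𝔸ˢ_{κ(y)} → 𝔸ˢ_Y` through it
  generalize hy : (𝔸(Fin s; Y) ↘ Y).base x = y
  set ιy : Spec (Y.residueField y) ⟶ Y := Y.fromSpecResidueField y with hιy
  -- (1) `x` is in the range of the fibre
  obtain ⟨x₀, hx₀, -⟩ := Scheme.exists_preimage_of_isPullback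
    (AffineSpace.isPullback_map (n := Fin s) ιy) x (default : Spec (Y.residueField y))
    (by rw [hy, hιy, Scheme.fromSpecResidueField_apply])
  -- (2) every point of the fibre lies over `y`
  have hover : ∀ z : ↥(𝔸(Fin s; Spec (Y.residueField y))),
      (𝔸(Fin s; Y) ↘ Y).base ((AffineSpace.map (Fin s) ιy).base z) = y := fun z => by
    rw [← Scheme.Hom.comp_apply, AffineSpace.map_over, Scheme.Hom.comp_apply, hιy,
      Scheme.fromSpecResidueField_apply]
  -- the generic point `γ` of the (irreducible) fibre; `ξ := 𝔸ˢ(ιy) γ`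
  refine ⟨(AffineSpace.map (Fin s) ιy).base (genericPoint ↥(𝔸(Fin s; Spec (Y.residueField y)))),
    hx₀ ▸ (genericPoint_specializes x₀).map (AffineSpace.map (Fin s) ιy).continuous, ?_, ?_⟩
  · rw [hover]
  · -- (3) both sides are the generic point of `𝔸ˢ_{𝔽_p}`
    have hR : (AffineSpace.map (Fin s) f).base (genericPoint ↥(𝔸(Fin s; Y))) =
        genericPoint ↥(𝔸(Fin s; Spec (.of (ZMod p)))) := by
      haveI : Surjective f := ⟨fun t => ⟨Nonempty.some inferInstance, Subsingleton.elim _ _⟩⟩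
      haveI : Surjective (AffineSpace.map (Fin s) f) :=
        MorphismProperty.of_isPullback (P := @Surjective) (AffineSpace.isPullback_map f).flip
          inferInstance
      exact apply_genericPoint_of_surjective _
    have hL : (AffineSpace.map (Fin s) f).base ((AffineSpace.map (Fin s) ιy).base
        (genericPoint ↥(𝔸(Fin s; Spec (Y.residueField y))))) =
          genericPoint ↥(𝔸(Fin s; Spec (.of (ZMod p)))) := by
      rw [← Scheme.Hom.comp_apply, ← AffineSpace.map_comp, ← Spec.map_preimage (ιy ≫ f)]
      exact affineSpace_map_SpecMap_genericPoint (Fin s) _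
        (Spec.preimage (ιy ≫ f)).hom.injective
    rw [hL, hR]

end Summit.ResolutionOfSingularities.ResolutionOfSingularities.Theorems.ProductDescent.Birth

end
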